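import Summits.HodgeConjecture.HodgeConjecture.Theses.TropicalWeilObstruction
import Summits.HodgeConjecture.HodgeConjecture.Theorems.TropicalWeilObstructionTropicalWeilVanishingDegreeLadderStokes
import Summits.HodgeConjecture.HodgeConjecture.Theorems.TropicalWeilObstructionTropicalHodgeBoundIntegralHodgeLattice
import Summits.HodgeConjecture.HodgeConjecture.Theorems.TropicalWeilObstructionTropicalWeilVanishingCalibrationCone
import Summits.HodgeConjecture.HodgeConjecture.Theorems.TropicalWeilObstructionTropicalHodgeBoundThetaLine
import Summits.HodgeConjecture.HodgeConjecture.Theorems.TropicalWeilObstructionTropicalHodgeBoundWeilClassesIndependent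
import HarnessLib

/-!
# Route `TropicalWeilObstruction` (Kontsevich's tropical test — NEGATION SINK, exploration, no summit claim):
# the degree ladder of K1 — II. the class lattice, and `W = 0` in small theta-degree

Negation-sink bookkeeping of the cell `pub-hodge-tropical` (seat tropical-1 gen 7); part II of the DEGREE LADDER
(part I: `…TropicalWeilVanishingDegreeLadderStokes`, `4 ∣ intCoord Z`). Setting: a very general principally polarised
tropical Weil eightfold `ℝ⁸/Qℤ⁸` (`Q ≻ 0`, `QJ = JQ`, `IsWeilGeneric 4 Q`), an effective tropical `4`-cycle `Z`, K3's
coordinates `cyc Z = q₀ θ₄(Q) + q₁ Re w(Q) + q₂ Im w(Q)` (p322554). INTEGRALITY is the one class-level input on K1 not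
used so far (class POSITIVITY is exhausted by the calibration cone: κ = 8, files `…ClassPositivity*`); its reach:

* `exists_int_coordinates_of_dvd` — `k ∣ intCoord Z` entrywise ⟹ `(24/k)·cyc Z ∈ ℤθ₄ ⊕ ℤ Re w ⊕ ℤ Im w` (tropical-2's
  classification `cl_eq_of_eigenwave`, p335583, run on `intCoord Z / k`); with part I: `six_smul_cyc_mem_intLattice`,
  **`(q₀,q₁,q₂) ∈ (1/6)ℤ³`** (K3 alone, `k = 1`: `(1/24)ℤ³`);
* `coords_unique`, `latticePoint_of_dvd`, `latticePoint` — with the calibration cone (p332805):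
  `6(q₀,q₁,q₂) = (a,b,c) ∈ ℤ³`, `a ≥ 0`, `64(b² + c²) ≤ a²`;
* **THE RUNG** `weilFunctional_eq_zero_of_thetaCoord_lt` (`_of_dvd`, `_of_mass_lt`; contrapositives
  `thetaCoord_ge_of_weilFunctional_ne_zero`, `mass_ge_of_weilFunctional_ne_zero`): `W(Z) ≠ 0` needs `(b,c) ≠ 0`, hence
  `a ≥ 8`: **every effective tropical `4`-cycle with `q₀ < 4/3` — e.g. in the minimal class `θ₄(Q)` — equivalently of
  hermitian mass `μ(Z) = Σ_σ w_σ a_σ |η_σ|² < (4/3)·det(P Q Pᴴ)`, has `W(Z) = 0`**; K1 asserts it for all `q₀`;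
* `weilFunctional_eq_zero_of_thetaCoord_lt_eight`, `weilCoords_sq_eq_one_of_thetaCoord_eq_eight` — under the FULL
  integrality `24 ∣ intCoord Z` (`[Z] ∈ ⋀⁴(Qℤ⁸) ⊗ ⋀⁴ℤ⁸`, Mikhalkin–Zharkov Prop. 4.3: true on paper, NOT in the tree
  beyond part I's factor `4`; a hypothesis on `Z` here, nothing is claimed): `q₀ < 8 ⟹ W(Z) = 0`, and a counterexample
  of theta-degree exactly `8` has `(q₁,q₂) ∈ {(±1,0),(0,±1)}` — class `8θ₄ ± Re w` or `8θ₄ ± Im w`, ON THE BOUNDARY of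
  the calibration cone (calibrated, `|W| = μ`). Since κ = 8 (p337681; all periods p340882/p342567) these four classes
  pass every class-level test: integrality + positivity prove K1 in theta-degree `< 8` and nothing beyond.

HONEST STATUS. K1 (`TropicalWeilVanishing`, stmt-HodgeConjecture-18478) is an OPEN problem of tropical geometry;
this file proves it for cycles of small theta-degree only and decides nothing about it in general, nor about the
Hodge conjecture. No definition (display-only notation), no named fact, no sorry.
References: [MikhalkinZharkov2014Eigenwave] G. Mikhalkin, I. Zharkov, LN UMI 15 (2014), Def. 4.2, Prop. 4.3, Thm. 5.4;
[Zharkov2020TropicalWeil] I. Zharkov, arXiv:2002.02347, §2 (pp. 2–4).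
-/

set_option linter.dupNamespace false

noncomputable section

open scoped BigOperators
open Matrix
open Literature.AlgebraicGeometry.Tropical
open Summit.HodgeConjecture.HodgeConjecture.Theorems.TropicalHodgeBound

namespace Summit.HodgeConjecture.HodgeConjecture.Theorems.TropicalWeilVanishing.Ladder

/-! ## §0 Display-only notation (the K3 skeleton's local definitions, verbatim bodies; nothing is defined) -/

/-- `P = [1 | i·1]`, the `n × 2n` matrix of `dz₁ ∧ … ∧ dz_n`. -/
local notation3 (prettyPrint := false) "𝐏⟦" n "⟧" =>
  (Matrix.of fun (k : Fin n) (a : Fin (2 * n)) =>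
    (if (a : ℕ) = (k : ℕ) then (1 : ℂ) else 0) + (if (a : ℕ) = (k : ℕ) + n then Complex.I else 0))

/-- The skeleton's `thetaClass n Q`. -/
local notation3 (prettyPrint := false) "θ⟦" n "⟧" Q:max =>
  (fun S S' : Fin n → Fin (2 * n) => Matrix.det (Matrix.submatrix Q S S'))

/-- The skeleton's `omegaFrame n` (`Ω = Pᴴ`). -/
local notation3 (prettyPrint := false) "Ω⟦" n "⟧" =>
  (Matrix.of fun (a : Fin (2 * n)) (b : Fin n) =>
    (if (a : ℕ) = (b : ℕ) then (1 : ℂ) else 0) - (if (a : ℕ) = (b : ℕ) + n then Complex.I else 0))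

/-- The skeleton's `weilClassC n Q` (`w(Q) = (⋀ⁿQ ⊗ 1)(Ω ⊗ Ω)`). -/
local notation3 (prettyPrint := false) "wC⟦" n "⟧" Q:max =>
  (fun S S' : Fin n → Fin (2 * n) =>
    Matrix.det (Matrix.submatrix (Matrix.map Q ((↑) : ℝ → ℂ) * Ω⟦n⟧) S id) *
      Matrix.det (Matrix.submatrix (Ω⟦n⟧) S' id))

/-- The skeleton's `weilClassRe n Q` (`w₁ = Re w`). -/
local notation3 (prettyPrint := false) "wRe⟦" n "⟧" Q:max =>
  (fun S S' : Fin n → Fin (2 * n) => Complex.re ((wC⟦n⟧ Q) S S'))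

/-- The skeleton's `weilClassIm n Q` (`w₂ = Im w`). -/
local notation3 (prettyPrint := false) "wIm⟦" n "⟧" Q:max =>
  (fun S S' : Fin n → Fin (2 * n) => Complex.im ((wC⟦n⟧ Q) S S'))

/-- NEW display-only notation: the hermitian MASS `μ(Z) = Σ_σ w_σ a_σ |η_σ|²` of an effective tropical `4`-cycle
(the value of `dz ⊗ dz̄` on `cyc Z`, `hermPairing_cyc`). Nothing is defined. -/
local notation3 (prettyPrint := false) "μ⟦" Z "⟧" =>
  (∑ σ, ((TropicalTorusCycle.cell Z σ).weight : ℝ) * (TropicalTorusCycle.cell Z σ).latticeVolume *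
    ‖frameComplexDet 4 (TropicalTorusCycle.cell Z σ).frame‖ ^ 2)

variable (Q : Matrix (Fin (2 * 4)) (Fin (2 * 4)) ℝ)

/-! ## §1 The class lattice -/

/-- **Divisibility of `intCoord Z` puts a multiple of the class on the integral Hodge lattice.** If `k ∣ intCoord Z (I,S')`
for all words, then at a Weil-generic `Q ≻ 0` (`QJ = JQ`): `(24/k) · cyc Z = a θ₄(Q) + b Re w(Q) + c Im w(Q)` with
`a, b, c ∈ ℤ` (the integer table `intCoord Z / k` is alternating and killed by the eigenwave, so tropical-2's
classification `cl_eq_of_eigenwave` applies). [cite: MikhalkinZharkov2014Eigenwave, Prop. 4.3 and Thm. 5.4]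
[cite: Zharkov2020TropicalWeil, §2] -/
theorem exists_int_coordinates_of_dvd (hQ : Q.PosDef) (hJ : Q * weilJ 4 = weilJ 4 * Q) (hgen : IsWeilGeneric 4 Q)
    (Z : TropicalTorusCycle (2 * 4) 4 Q) (k : ℕ) (hk : 0 < k) (hdiv : ∀ I S', (k : ℤ) ∣ intCoord Z I S') :
    ∃ a b c : ℤ, ((24 : ℝ) / k) • Z.cyc = (a : ℝ) • θ⟦4⟧ Q + (b : ℝ) • wRe⟦4⟧ Q + (c : ℝ) • wIm⟦4⟧ Q := by
  classical
  have hS : ∀ α β, Q α β = Q β α := fun α β => by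
    simpa using (hQ.isHermitian.apply α β).symm
  have hdet : IsUnit Q.det := hQ.det_pos.ne'.isUnit
  have hk0 : (k : ℝ) ≠ 0 := by exact_mod_cast hk.ne'
  -- the integer table `y = intCoord Z / k`
  set y : (Fin 4 → Fin (2 * 4)) → (Fin 4 → Fin (2 * 4)) → ℤ := fun I J => intCoord Z I J / k with hy
  have hcast : ∀ I J, ((intCoord Z I J : ℤ) : ℝ) = (k : ℝ) * ((y I J : ℤ) : ℝ) := by
    intro I J
    have h := Int.ediv_mul_cancel (hdiv I J)
    have e : ((intCoord Z I J : ℤ) : ℝ) = ((intCoord Z I J / k * k : ℤ) : ℝ) := by rw [h]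
    rw [e]; push_cast; simp only [hy]; ring
  have hyI : ∀ (c d : Fin 4 → Fin (2 * 4)) (τ : Equiv.Perm (Fin 4)),
      y (c ∘ τ) d = ((Equiv.Perm.sign τ : ℤˣ) : ℤ) * y c d := by
    intro c d τ
    simp only [hy]
    rw [intCoord_comp_perm_left, Int.mul_ediv_assoc _ (hdiv c d)]
  have hyJ : ∀ (c d : Fin 4 → Fin (2 * 4)) (τ : Equiv.Perm (Fin 4)),
      y c (d ∘ τ) = ((Equiv.Perm.sign τ : ℤˣ) : ℤ) * y c d := by
    intro c d τ
    simp only [hy]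
    rw [intCoord_comp_perm_right, Int.mul_ediv_assoc _ (hdiv c d)]
  -- `cl⟦Q⟧ y = (24/k) · cyc Z`
  have hcl : ∀ S S' : Fin 4 → Fin (2 * 4),
      (1 / 24 : ℝ) * ∑ I : Fin 4 → Fin (2 * 4), (Q.submatrix S I).det * ((y I S' : ℤ) : ℝ) =
        (24 : ℝ) / k * Z.cyc S S' := by
    intro S S'
    rw [cyc_eq_sum_det_mul_intCoord hdet Z S S']
    simp_rw [hcast]
    have e : ∑ I : Fin 4 → Fin (2 * 4), (Q.submatrix S I).det * ((k : ℝ) * ((y I S' : ℤ) : ℝ)) =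
        (k : ℝ) * ∑ I : Fin 4 → Fin (2 * 4), (Q.submatrix S I).det * ((y I S' : ℤ) : ℝ) := by
      rw [Finset.mul_sum]
      exact Finset.sum_congr rfl fun I _ => by ring
    rw [e]
    field_simp
    ring
  -- the eigenwave kills `cl⟦Q⟧ y`
  have heig : ∀ (K' : Fin 5 → Fin (2 * 4)) (J' : Fin 3 → Fin (2 * 4)),
      ∑ m : Fin 5, (-1 : ℝ) ^ (m : ℕ) *
        (fun S S' : Fin 4 → Fin (2 * 4) => (1 / 24 : ℝ) * ∑ I : Fin 4 → Fin (2 * 4),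
          Matrix.det (Matrix.submatrix Q S I) * ((y I S' : ℤ) : ℝ))
          (fun a => K' (m.succAbove a)) (Fin.cons (K' m) J') = 0 := by
    intro K' J'
    beta_reduce
    simp_rw [hcl]
    have h := cyc_eigenwave Z K' J'
    calc ∑ m : Fin 5, (-1 : ℝ) ^ (m : ℕ) *
          ((24 : ℝ) / k * Z.cyc (fun a => K' (m.succAbove a)) (Fin.cons (K' m) J'))
        = (24 : ℝ) / k * ∑ m : Fin 5, (-1 : ℝ) ^ (m : ℕ) *
            Z.cyc (fun a => K' (m.succAbove a)) (Fin.cons (K' m) J') := by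
          rw [Finset.mul_sum]
          exact Finset.sum_congr rfl fun m _ => by ring
      _ = 0 := by rw [h, mul_zero]
  obtain ⟨a, b, c, habc⟩ := cl_eq_of_eigenwave Q hS hJ hgen y hyI hyJ heig
  refine ⟨a, b, c, ?_⟩
  rw [← habc]
  funext S S'
  rw [Pi.smul_apply, Pi.smul_apply, smul_eq_mul]
  exact (hcl S S').symm

/-- **The K3 coordinates lie in `(1/6)ℤ³`** (part I's `4 ∣ intCoord Z`): `6 · cyc Z = a θ₄(Q) + b Re w(Q) + c Im w(Q)`,
`a, b, c ∈ ℤ`. [cite: MikhalkinZharkov2014Eigenwave, Prop. 4.3 and Thm. 5.4] -/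
theorem six_smul_cyc_mem_intLattice (hQ : Q.PosDef) (hJ : Q * weilJ 4 = weilJ 4 * Q) (hgen : IsWeilGeneric 4 Q)
    (Z : TropicalTorusCycle (2 * 4) 4 Q) :
    ∃ a b c : ℤ, (6 : ℝ) • Z.cyc = (a : ℝ) • θ⟦4⟧ Q + (b : ℝ) • wRe⟦4⟧ Q + (c : ℝ) • wIm⟦4⟧ Q := by
  have hdet : IsUnit Q.det := hQ.det_pos.ne'.isUnit
  obtain ⟨a, b, c, h⟩ := exists_int_coordinates_of_dvd Q hQ hJ hgen Z 4 (by norm_num)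
    (fun I S' => four_dvd_intCoord hdet Z I S')
  refine ⟨a, b, c, ?_⟩
  rw [← h]
  norm_num

/-! ## §2 Uniqueness of the coordinates; the lattice points lie in the calibration cone -/

/-- The coordinates on `θ₄(Q), Re w(Q), Im w(Q)` are unique (`Q ≻ 0`, `QJ = JQ`; linear independence, p335385).
[cite: Zharkov2020TropicalWeil, §2] -/
theorem coords_unique (hQ : Q.PosDef) (hJ : Q * weilJ 4 = weilJ 4 * Q) {a b c a' b' c' : ℝ}
    (h : a • θ⟦4⟧ Q + b • wRe⟦4⟧ Q + c • wIm⟦4⟧ Q = a' • θ⟦4⟧ Q + b' • wRe⟦4⟧ Q + c' • wIm⟦4⟧ Q) :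
    a = a' ∧ b = b' ∧ c = c' := by
  have hli := linearIndependent_thetaClass_weilClasses (by norm_num : 0 < 4) Q hQ hJ
  rw [Fintype.linearIndependent_iff] at hli
  have h0 := hli ![a - a', b - b', c - c'] (by
    rw [Fin.sum_univ_three]
    simp only [Matrix.cons_val_zero, Matrix.cons_val_one, Matrix.cons_val_two, Matrix.tail_cons,
      Matrix.head_cons]
    rw [sub_smul, sub_smul, sub_smul]
    linear_combination h)
  have e0 := h0 0
  have e1 := h0 1
  have e2 := h0 2
  simp only [Matrix.cons_val_zero, Matrix.cons_val_one, Matrix.cons_val_two, Matrix.tail_cons,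
    Matrix.head_cons] at e0 e1 e2
  exact ⟨sub_eq_zero.mp e0, sub_eq_zero.mp e1, sub_eq_zero.mp e2⟩

/-- **Lattice points in the cone.** If `k ∣ intCoord Z` entrywise then `(24/k)·cyc Z = a θ₄ + b Re w + c Im w` with INTEGERS
`a ≥ 0` and `64 (b² + c²) ≤ a²` (calibration cone, p332805). [cite: Zharkov2020TropicalWeil, §2]
[cite: MikhalkinZharkov2014Eigenwave, Prop. 4.3 and Thm. 5.4] -/
theorem latticePoint_of_dvd (hQ : Q.PosDef) (hJ : Q * weilJ 4 = weilJ 4 * Q) (hgen : IsWeilGeneric 4 Q)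
    (Z : TropicalTorusCycle (2 * 4) 4 Q) (k : ℕ) (hk : 0 < k) (hdiv : ∀ I S', (k : ℤ) ∣ intCoord Z I S') :
    ∃ a b c : ℤ, ((24 : ℝ) / k) • Z.cyc = (a : ℝ) • θ⟦4⟧ Q + (b : ℝ) • wRe⟦4⟧ Q + (c : ℝ) • wIm⟦4⟧ Q ∧
      0 ≤ a ∧ 64 * (b ^ 2 + c ^ 2) ≤ a ^ 2 := by
  obtain ⟨a, b, c, h⟩ := exists_int_coordinates_of_dvd Q hQ hJ hgen Z k hk hdiv
  obtain ⟨q, hq, hq0, hcone⟩ := effective_cyc_mem_calibrationCone Q hQ hJ hgen Z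
  have hkR : (0 : ℝ) < k := by exact_mod_cast hk
  have hs : (0 : ℝ) < 24 / k := by positivity
  have hq' : ((24 : ℝ) / k) • Z.cyc = ((24 : ℝ) / k * ((q 0 : ℚ) : ℝ)) • θ⟦4⟧ Q +
      ((24 : ℝ) / k * ((q 1 : ℚ) : ℝ)) • wRe⟦4⟧ Q + ((24 : ℝ) / k * ((q 2 : ℚ) : ℝ)) • wIm⟦4⟧ Q := by
    rw [hq]
    simp only [smul_add, smul_smul]
  obtain ⟨ea, eb, ec⟩ := coords_unique Q hQ hJ (h.symm.trans hq')
  refine ⟨a, b, c, h, ?_, ?_⟩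
  · have hq0R : (0 : ℝ) ≤ ((q 0 : ℚ) : ℝ) := by exact_mod_cast hq0
    have : (0 : ℝ) ≤ (a : ℝ) := by rw [ea]; exact mul_nonneg hs.le hq0R
    exact_mod_cast this
  · have hconeR : (64 : ℝ) * (((q 1 : ℚ) : ℝ) ^ 2 + ((q 2 : ℚ) : ℝ) ^ 2) ≤ ((q 0 : ℚ) : ℝ) ^ 2 := by
      exact_mod_cast hcone
    have : (64 : ℝ) * ((b : ℝ) ^ 2 + (c : ℝ) ^ 2) ≤ (a : ℝ) ^ 2 := by
      rw [ea, eb, ec]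
      nlinarith [hconeR, sq_nonneg ((24 : ℝ) / k)]
    exact_mod_cast this

/-- **The effective classes at a very general Weil period lie on the lattice points of the cone**:
`6 · cyc Z = a θ₄(Q) + b Re w(Q) + c Im w(Q)` with integers `a ≥ 0`, `64 (b² + c²) ≤ a²`.
[cite: Zharkov2020TropicalWeil, §2] [cite: MikhalkinZharkov2014Eigenwave, Prop. 4.3 and Thm. 5.4] -/
theorem latticePoint (hQ : Q.PosDef) (hJ : Q * weilJ 4 = weilJ 4 * Q) (hgen : IsWeilGeneric 4 Q)
    (Z : TropicalTorusCycle (2 * 4) 4 Q) :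
    ∃ a b c : ℤ, (6 : ℝ) • Z.cyc = (a : ℝ) • θ⟦4⟧ Q + (b : ℝ) • wRe⟦4⟧ Q + (c : ℝ) • wIm⟦4⟧ Q ∧
      0 ≤ a ∧ 64 * (b ^ 2 + c ^ 2) ≤ a ^ 2 := by
  have hdet : IsUnit Q.det := hQ.det_pos.ne'.isUnit
  obtain ⟨a, b, c, h, ha, hcone⟩ := latticePoint_of_dvd Q hQ hJ hgen Z 4 (by norm_num)
    (fun I S' => four_dvd_intCoord hdet Z I S')
  refine ⟨a, b, c, ?_, ha, hcone⟩
  rw [← h]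
  norm_num

/-! ## §3 The rung: `W(Z) = 0` in small theta-degree -/

/-- **The rung, general form.** If `k ∣ intCoord Z` entrywise and `cyc Z = q₀ θ₄(Q) + q₁ Re w(Q) + q₂ Im w(Q)` with
`q₀ < k/3`, then `W(Z) = 0`: the lattice point `(a,b,c) = (24/k)(q₀,q₁,q₂) ∈ ℤ³` has `0 ≤ a < 8`, so `64(b² + c²) ≤ a² ≤ 49`
forces `b = c = 0`, the class is a multiple of `θ₄(Q)`, and `Ŵ(θ₄) = 0`. [cite: Zharkov2020TropicalWeil, §2]
[cite: MikhalkinZharkov2014Eigenwave, Prop. 4.3 and Thm. 5.4] -/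
theorem weilFunctional_eq_zero_of_thetaCoord_lt_of_dvd (hQ : Q.PosDef) (hJ : Q * weilJ 4 = weilJ 4 * Q)
    (hgen : IsWeilGeneric 4 Q) (Z : TropicalTorusCycle (2 * 4) 4 Q) (k : ℕ) (hk : 0 < k)
    (hdiv : ∀ I S', (k : ℤ) ∣ intCoord Z I S') {q₀ q₁ q₂ : ℝ}
    (hq : Z.cyc = q₀ • θ⟦4⟧ Q + q₁ • wRe⟦4⟧ Q + q₂ • wIm⟦4⟧ Q) (hlt : q₀ < k / 3) :
    weilFunctional Z = 0 := by
  obtain ⟨a, b, c, h, ha0, hcone⟩ := latticePoint_of_dvd Q hQ hJ hgen Z k hk hdiv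
  have hkR : (0 : ℝ) < k := by exact_mod_cast hk
  have hs : (0 : ℝ) < 24 / k := by positivity
  have hq' : ((24 : ℝ) / k) • Z.cyc = ((24 : ℝ) / k * q₀) • θ⟦4⟧ Q + ((24 : ℝ) / k * q₁) • wRe⟦4⟧ Q +
      ((24 : ℝ) / k * q₂) • wIm⟦4⟧ Q := by
    rw [hq]
    simp only [smul_add, smul_smul]
  obtain ⟨ea, eb, ec⟩ := coords_unique Q hQ hJ (h.symm.trans hq')
  -- `a < 8`
  have ha8R : (a : ℝ) < 8 := by
    have h1 : (24 : ℝ) / k * q₀ < (24 : ℝ) / k * (k / 3) := mul_lt_mul_of_pos_left hlt hs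
    have h2 : (24 : ℝ) / k * (k / 3) = 8 := by field_simp; ring
    linarith
  have ha8 : a < 8 := by exact_mod_cast ha8R
  have ha7 : a ≤ 7 := by omega
  -- `b = c = 0`
  have h49 : 64 * (b ^ 2 + c ^ 2) ≤ 49 := by nlinarith [hcone, ha0, ha7]
  have hb2 : b ^ 2 ≤ 0 := Int.lt_add_one_iff.mp (by nlinarith [sq_nonneg b, sq_nonneg c])
  have hc2 : c ^ 2 ≤ 0 := Int.lt_add_one_iff.mp (by nlinarith [sq_nonneg b, sq_nonneg c])
  have hb : b = 0 := pow_eq_zero_iff (n := 2) (by norm_num) |>.mp (le_antisymm hb2 (sq_nonneg b))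
  have hc : c = 0 := pow_eq_zero_iff (n := 2) (by norm_num) |>.mp (le_antisymm hc2 (sq_nonneg c))
  -- hence `q₁ = q₂ = 0` and the class is a multiple of `θ₄(Q)`
  have hq1 : q₁ = 0 := by
    have e : (24 : ℝ) / k * q₁ = 0 := by rw [← eb, hb]; simp
    exact (mul_eq_zero.mp e).resolve_left hs.ne'
  have hq2 : q₂ = 0 := by
    have e : (24 : ℝ) / k * q₂ = 0 := by rw [← ec, hc]; simp
    exact (mul_eq_zero.mp e).resolve_left hs.ne'
  rw [hq1, hq2, zero_smul, zero_smul, add_zero, add_zero] at hq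
  exact weilFunctional_eq_zero_of_cyc_eq_smul_thetaClass Q hJ Z q₀ hq

/-- **THE RUNG (unconditional): small theta-degree forces `W = 0`.** On a very general principally polarised
tropical Weil eightfold, every effective tropical `4`-cycle whose class `q₀ θ₄(Q) + q₁ Re w(Q) + q₂ Im w(Q)` has
`q₀ < 4/3` — in particular every effective cycle in the minimal class `θ₄(Q)` or below it — has `W(Z) = 0`
(integrality `(1/6)ℤ³` + calibration cone). K1 asserts this for all `q₀`. [cite: Zharkov2020TropicalWeil, §2]
[cite: MikhalkinZharkov2014Eigenwave, Prop. 4.3 and Thm. 5.4] -/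
theorem weilFunctional_eq_zero_of_thetaCoord_lt (hQ : Q.PosDef) (hJ : Q * weilJ 4 = weilJ 4 * Q)
    (hgen : IsWeilGeneric 4 Q) (Z : TropicalTorusCycle (2 * 4) 4 Q) {q₀ q₁ q₂ : ℝ}
    (hq : Z.cyc = q₀ • θ⟦4⟧ Q + q₁ • wRe⟦4⟧ Q + q₂ • wIm⟦4⟧ Q) (hlt : q₀ < 4 / 3) :
    weilFunctional Z = 0 := by
  have hdet : IsUnit Q.det := hQ.det_pos.ne'.isUnit
  exact weilFunctional_eq_zero_of_thetaCoord_lt_of_dvd Q hQ hJ hgen Z 4 (by norm_num)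
    (fun I S' => four_dvd_intCoord hdet Z I S') hq (by push_cast; linarith)

/-- Contrapositive: **a counterexample to K1 has theta-degree `q₀ ≥ 4/3`.** [cite: Zharkov2020TropicalWeil, §2] -/
theorem thetaCoord_ge_of_weilFunctional_ne_zero (hQ : Q.PosDef) (hJ : Q * weilJ 4 = weilJ 4 * Q)
    (hgen : IsWeilGeneric 4 Q) (Z : TropicalTorusCycle (2 * 4) 4 Q) {q₀ q₁ q₂ : ℝ}
    (hq : Z.cyc = q₀ • θ⟦4⟧ Q + q₁ • wRe⟦4⟧ Q + q₂ • wIm⟦4⟧ Q) (hW : weilFunctional Z ≠ 0) :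
    4 / 3 ≤ q₀ :=
  not_lt.mp fun h => hW (weilFunctional_eq_zero_of_thetaCoord_lt Q hQ hJ hgen Z hq h)

/-- **THE RUNG, intrinsic form: small hermitian mass forces `W = 0`.** If the mass `μ(Z) = Σ_σ w_σ a_σ |η_σ|²`
(computable from the cells) is `< (4/3) · det(P Q Pᴴ)` (`det(P Q Pᴴ) = μ̂(θ₄(Q)) > 0`; `μ(Z) = q₀ det(P Q Pᴴ)` by
`hermPairing_cyc`, p331596), then `W(Z) = 0`. [cite: Zharkov2020TropicalWeil, §2]
[cite: MikhalkinZharkov2014Eigenwave, Prop. 4.3 and Thm. 5.4] -/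
theorem weilFunctional_eq_zero_of_mass_lt (hQ : Q.PosDef) (hJ : Q * weilJ 4 = weilJ 4 * Q)
    (hgen : IsWeilGeneric 4 Q) (Z : TropicalTorusCycle (2 * 4) 4 Q)
    (hμ : μ⟦Z⟧ < 4 / 3 * ((𝐏⟦4⟧ * Q.map ((↑) : ℝ → ℂ) * (𝐏⟦4⟧)ᴴ).det).re) :
    weilFunctional Z = 0 := by
  obtain ⟨q, hq⟩ := stub_rationalHodgeCoordinates Q hQ hJ hgen Z
  have h4 : (0 : ℕ) < 4 := by norm_num
  -- `μ(Z) = q₀ · det(P Q Pᴴ)`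
  have hM0 := hermPairing_cyc Q Z
  generalize hm : μ⟦Z⟧ = m at hμ hM0
  rw [hq, hermPairing_lincomb, hermPairing_thetaClass_eq_det, hermPairing_weilClassRe_eq_zero h4 Q hJ,
    hermPairing_weilClassIm_eq_zero h4 Q hJ, mul_zero, mul_zero, add_zero, add_zero] at hM0
  obtain ⟨hDre, hDim⟩ := det_frame_mul_map_mul_conjTranspose_pos Q hQ
  generalize hD : (𝐏⟦4⟧ * Q.map ((↑) : ℝ → ℂ) * (𝐏⟦4⟧)ᴴ).det = D at hDre hDim hM0 hμ
  obtain ⟨d, rfl⟩ : ∃ d : ℝ, (d : ℂ) = D := ⟨D.re, Complex.ext (by simp) (by simp [hDim])⟩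
  rw [Complex.ofReal_re] at hDre hμ
  have hmq : ((q 0 : ℚ) : ℝ) * d = m := by exact_mod_cast hM0
  -- `q₀ < 4/3`
  have hq0 : ((q 0 : ℚ) : ℝ) < 4 / 3 := by
    by_contra hge
    push Not at hge
    have : 4 / 3 * d ≤ ((q 0 : ℚ) : ℝ) * d := mul_le_mul_of_nonneg_right hge hDre.le
    linarith
  exact weilFunctional_eq_zero_of_thetaCoord_lt Q hQ hJ hgen Z hq hq0

/-- Contrapositive, intrinsic form: **a counterexample to K1 has mass `μ(Z) ≥ (4/3) · det(P Q Pᴴ)`.**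
[cite: Zharkov2020TropicalWeil, §2] -/
theorem mass_ge_of_weilFunctional_ne_zero (hQ : Q.PosDef) (hJ : Q * weilJ 4 = weilJ 4 * Q)
    (hgen : IsWeilGeneric 4 Q) (Z : TropicalTorusCycle (2 * 4) 4 Q) (hW : weilFunctional Z ≠ 0) :
    4 / 3 * ((𝐏⟦4⟧ * Q.map ((↑) : ℝ → ℂ) * (𝐏⟦4⟧)ᴴ).det).re ≤ μ⟦Z⟧ :=
  not_lt.mp fun h => hW (weilFunctional_eq_zero_of_mass_lt Q hQ hJ hgen Z h)

/-! ## §4 Under full integrality of the class (`24 ∣ intCoord Z`): the first open degree is `8` -/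

/-- **Under full integrality (`24 ∣ intCoord Z`, i.e. `[Z] ∈ ⋀⁴(Qℤ⁸) ⊗ ⋀⁴ℤ⁸` — a hypothesis on `Z`, not proved in
the tree), theta-degree `q₀ < 8` forces `W(Z) = 0`.** By κ = 8 (`Kappa.boundaryRay_eq_sum_frameSquares`) no class-level
argument reaches `q₀ = 8`. [cite: MikhalkinZharkov2014Eigenwave, Prop. 4.3 and Thm. 5.4] [cite: Zharkov2020TropicalWeil, §2] -/
theorem weilFunctional_eq_zero_of_thetaCoord_lt_eight (hQ : Q.PosDef) (hJ : Q * weilJ 4 = weilJ 4 * Q)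
    (hgen : IsWeilGeneric 4 Q) (Z : TropicalTorusCycle (2 * 4) 4 Q)
    (h24 : ∀ I S', (24 : ℤ) ∣ intCoord Z I S') {q₀ q₁ q₂ : ℝ}
    (hq : Z.cyc = q₀ • θ⟦4⟧ Q + q₁ • wRe⟦4⟧ Q + q₂ • wIm⟦4⟧ Q) (hlt : q₀ < 8) :
    weilFunctional Z = 0 :=
  weilFunctional_eq_zero_of_thetaCoord_lt_of_dvd Q hQ hJ hgen Z 24 (by norm_num)
    (fun I S' => by exact_mod_cast h24 I S') hq (by push_cast; linarith)

/-- **Under full integrality, a counterexample of theta-degree exactly `8` is calibrated**: `q₁² + q₂² = 1`, i.e. its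
class is one of `8θ₄ ± Re w`, `8θ₄ ± Im w`, ON THE BOUNDARY `64(q₁² + q₂²) = q₀²` of the calibration cone
(`|W(Z)| = μ(Z)`). [cite: Zharkov2020TropicalWeil, §2] [cite: MikhalkinZharkov2014Eigenwave, Prop. 4.3 and Thm. 5.4] -/
theorem weilCoords_sq_eq_one_of_thetaCoord_eq_eight (hQ : Q.PosDef) (hJ : Q * weilJ 4 = weilJ 4 * Q)
    (hgen : IsWeilGeneric 4 Q) (Z : TropicalTorusCycle (2 * 4) 4 Q)
    (h24 : ∀ I S', (24 : ℤ) ∣ intCoord Z I S') {q₀ q₁ q₂ : ℝ}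
    (hq : Z.cyc = q₀ • θ⟦4⟧ Q + q₁ • wRe⟦4⟧ Q + q₂ • wIm⟦4⟧ Q) (h8 : q₀ = 8) (hW : weilFunctional Z ≠ 0) :
    q₁ ^ 2 + q₂ ^ 2 = 1 ∧ (q₁ = 0 ∨ q₂ = 0) := by
  obtain ⟨a, b, c, h, -, hcone⟩ := latticePoint_of_dvd Q hQ hJ hgen Z 24 (by norm_num)
    (fun I S' => by exact_mod_cast h24 I S')
  have hq' : ((24 : ℝ) / (24 : ℕ)) • Z.cyc = ((24 : ℝ) / (24 : ℕ) * q₀) • θ⟦4⟧ Q +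
      ((24 : ℝ) / (24 : ℕ) * q₁) • wRe⟦4⟧ Q + ((24 : ℝ) / (24 : ℕ) * q₂) • wIm⟦4⟧ Q := by
    rw [hq]
    simp only [smul_add, smul_smul]
  obtain ⟨ea, eb, ec⟩ := coords_unique Q hQ hJ (h.symm.trans hq')
  norm_num at ea eb ec
  -- `a = 8`, `b² + c² ≤ 1`
  have ha : a = 8 := by
    have e : (a : ℝ) = 8 := by rw [ea, h8]
    exact_mod_cast e
  rw [ha] at hcone
  have hle : b ^ 2 + c ^ 2 ≤ 1 := by linarith
  -- `(b,c) ≠ 0` since `W ≠ 0`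
  have hne : b ^ 2 + c ^ 2 ≠ 0 := by
    intro h0
    have hb : b = 0 := pow_eq_zero_iff (n := 2) (by norm_num) |>.mp (by nlinarith [sq_nonneg b, sq_nonneg c])
    have hc : c = 0 := pow_eq_zero_iff (n := 2) (by norm_num) |>.mp (by nlinarith [sq_nonneg b, sq_nonneg c])
    have hq1 : q₁ = 0 := by rw [← eb, hb]; simp
    have hq2 : q₂ = 0 := by rw [← ec, hc]; simp
    rw [hq1, hq2, zero_smul, zero_smul, add_zero, add_zero] at hq
    exact hW (weilFunctional_eq_zero_of_cyc_eq_smul_thetaClass Q hJ Z q₀ hq)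
  have hpos : 0 < b ^ 2 + c ^ 2 := lt_of_le_of_ne (by positivity) (Ne.symm hne)
  have hone : b ^ 2 + c ^ 2 = 1 := le_antisymm hle (by omega)
  -- one of `b`, `c` vanishes
  have hbc : b = 0 ∨ c = 0 := by
    by_contra hh
    push Not at hh
    have hb1 : 1 ≤ b ^ 2 := by
      have := Int.one_le_abs hh.1
      nlinarith [abs_nonneg b, sq_abs b]
    have hc1 : 1 ≤ c ^ 2 := by
      have := Int.one_le_abs hh.2
      nlinarith [abs_nonneg c, sq_abs c]
    omega
  refine ⟨?_, ?_⟩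
  · have : (b : ℝ) ^ 2 + (c : ℝ) ^ 2 = 1 := by exact_mod_cast hone
    rw [← eb, ← ec]; exact this
  · rcases hbc with hb | hc
    · left; rw [← eb, hb]; simp
    · right; rw [← ec, hc]; simp

end Summit.HodgeConjecture.HodgeConjecture.Theorems.TropicalWeilVanishing.Ladder

end
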